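import Literature.NumberTheory.EllipticCurves.TwoVariableAnticyclotomicControl
import Mathlib.Algebra.Module.CharacterModule
import HarnessLib

/-!
# Exact anticyclotomic control, Pontryagin-duality half: `X_Gr₂ ⧸ T₁X_Gr₂ → X_ac` is injective as soon as
# restriction `Sel_ac(E/K_∞⁻) → Sel(E/K̃_∞)^{γ₁ = 1}` is onto (line `bdpline` v12, stub TS2, crux stmt-BirchSwinnertonDyer-20727)

Helper file (`--supports stmt-BirchSwinnertonDyer-20727`) of the lead-prover seat bsd-line-sbc-p1 (gen 2).
Skeleton v12 of line `bdpline` carries the registered stub `stub_exactControlSS` (adopted from the ideator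
bsd-idea-14's splice `torsplice`): the control map on the quotient,
`WeierstrassCurve.XGr₂.toXAcQuot : X_Gr₂ ⧸ (T₁)·X_Gr₂ → X_ac` (tree `TwoVariableAnticyclotomicControl`,
surjective by `toXAcQuot_surjective`), is INJECTIVE at a good supersingular prime. This file proves the
PONTRYAGIN-DUALITY half of that statement, reducing it to its Galois-cohomological core:

* `AddMonoidHom.exists_comp_eq_of_forall_ker` — a character `x : S → ℚ/ℤ` of an abelian group that
  vanishes on `ker φ` (`φ : S →+ S`) is of the form `y ∘ φ` (divisibility of `ℚ/ℤ`, Mathlib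
  `CharacterModule.dual_surjective_of_injective`);
* `WeierstrassCurve.XGr₂.mem_X_smul_top_of_forall` — an element of `X_Gr₂ = Hom(H¹_{nr,v̄}(K̃_∞, E[p^∞]), ℚ/ℤ)`
  vanishing on the `conj_{γ₁}`-fixed classes lies in `(T₁)·X_Gr₂` (`T₁` acts as `conj_{γ₁} − 1`);
* `WeierstrassCurve.XGr₂.toXAcQuot_injective_of_forall_mem_range` — **if every `conj_{γ₁}`-fixed class of
  `H¹_{nr,v̄}(K̃_∞, E[p^∞])` is the restriction of a class of `Sel_v̄(K_∞⁻, E[p^∞])`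
  (`selmerAcToUnrSelmer₂`), then `toXAcQuot` is injective** — for every number field `K`, curve, prime
  and generator pair (no arithmetic hypothesis is used in this direction).

What remains for TS2 is the COHOMOLOGY: surjectivity of restriction onto the `γ₁`-invariants
(inflation–restriction along the procyclic `Gal(K̃_∞/K_∞⁻)` with `E(K̃_∞)[p^∞] = 0`, plus the local
conditions: inertia conditions agree away from `p`, nothing at `v`, and at `v̄` no `p`-power torsion over
`ℚ_p^{ab}·ℚ_p^{nr}` for a supersingular curve) — Skinner–Urban 2014 Prop. 3.2.8 / Greenberg LNM 1716 §3
shape; Castella–Wan (Math. Ann. 2023, arXiv:1607.02019) proof of Thm. 6.1: "the natural restriction map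
induces a Λ_ac-module isomorphism 𝔛_𝔭(K,𝐀)/I^cyc 𝔛_𝔭(K,𝐀) ≃ 𝔛_𝔭(K,𝐀^ac)". Pure algebra over the tree's
constructed carriers; nothing about elliptic curves is asserted; no new definitions.
-/

-- D-0017: single-problem summit, the namespace repeats the problem name by design.
set_option linter.dupNamespace false
set_option autoImplicit false

noncomputable section

open scoped Classical

universe u

/-! ## §1. Characters vanishing on a kernel factor through the endomorphism -/

namespace AddMonoidHom

/-- **A character of an abelian group vanishing on `ker φ` is of the form `y ∘ φ`** (`φ` an
endomorphism). The character descends to `S ⧸ ker φ ≅ range φ` and extends from `range φ ≤ S` to `S`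
because `ℚ/ℤ` is divisible (`CharacterModule.dual_surjective_of_injective`). [folklore] -/
theorem exists_comp_eq_of_forall_ker {S : Type u} [AddCommGroup S] (φ : AddMonoid.End S)
    (x : S →+ AddCircle (1 : ℚ)) (hx : ∀ s : S, φ s = 0 → x s = 0) :
    ∃ y : S →+ AddCircle (1 : ℚ), ∀ s : S, y (φ s) = x s := by
  let φ' : S →+ S := φ
  have hφ' : ∀ s : S, φ' s = φ s := fun _ ↦ rfl
  -- descend `x` to the quotient by `ker φ`, identified with `range φ`
  let x' : S ⧸ φ'.ker →+ AddCircle (1 : ℚ) :=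
    QuotientAddGroup.lift φ'.ker x fun s hs ↦ hx s (by rw [← hφ']; exact φ'.mem_ker.mp hs)
  let e : S ⧸ φ'.ker ≃+ φ'.range := QuotientAddGroup.quotientKerEquivRange φ'
  let χ : φ'.range →+ AddCircle (1 : ℚ) := x'.comp e.symm.toAddMonoidHom
  -- extend `χ` along the injection `range φ ↪ S`
  have hinj : Function.Injective (φ'.range.subtype.toIntLinearMap) := fun a b h ↦ Subtype.ext h
  obtain ⟨y, hy⟩ := CharacterModule.dual_surjective_of_injective _ hinj χ
  let y' : S →+ AddCircle (1 : ℚ) := y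
  refine ⟨y', fun s ↦ ?_⟩
  have h1 : y' (φ s) = χ ⟨φ' s, ⟨s, rfl⟩⟩ := DFunLike.congr_fun hy ⟨φ' s, ⟨s, rfl⟩⟩
  have he : e.symm ⟨φ' s, ⟨s, rfl⟩⟩ = (QuotientAddGroup.mk s : S ⧸ φ'.ker) := by
    apply e.injective
    rw [AddEquiv.apply_symm_apply]
    rfl
  have h2 : χ ⟨φ' s, ⟨s, rfl⟩⟩ = x' (QuotientAddGroup.mk s) := by
    show x' (e.symm ⟨φ' s, ⟨s, rfl⟩⟩) = _
    rw [he]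
  rw [h1, h2]
  rfl

end AddMonoidHom

/-! ## §2. `X_Gr₂`: vanishing on the `γ₁`-fixed classes ⟹ divisible by `T₁`; injectivity of `toXAcQuot` -/

namespace WeierstrassCurve.XGr₂

open NumberField IsDedekindDomain Field
  Literature.NumberTheory.EllipticCurves Literature.NumberTheory.EllipticCurves.Castella2018
  Literature.NumberTheory.EllipticCurves.TwoVariableSelmer

variable {K : Type u} [Field K] [NumberField K] (W : WeierstrassCurve K) (p : ℕ) [Fact p.Prime]
  (κ₁ κ₂ : ZpExtension K p) (vbar : HeightOneSpectrum (𝓞 K)) (γ₁ γ₂ : Field.absoluteGaloisGroup K)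
  [hγ : Fact (ZpExtension.IsTopGeneratorPair κ₁ κ₂ γ₁ γ₂)] [Fact (κ₂.IsTopGenerator γ₂)]

omit [Fact (κ₂.IsTopGenerator γ₂)] in
/-- **An element of `X_Gr₂` vanishing on the `conj_{γ₁}`-fixed classes lies in `(T₁)·X_Gr₂`.** Since
`T₁` acts on `X_Gr₂ = Hom(H¹_{nr,v̄}(K̃_∞, E[p^∞]), ℚ/ℤ)` as precomposition with `conj_{γ₁} − 1`
(`X_smul_apply`), a character killing `ker (conj_{γ₁} − 1)` is `T₁ • y` for the `y` of
`AddMonoidHom.exists_comp_eq_of_forall_ker`. [folklore] -/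
theorem mem_X_smul_top_of_forall (x : W.XGr₂ p κ₁ κ₂ vbar γ₁ γ₂)
    (hx : ∀ s : unrSelmer₂ κ₁ κ₂ (geomPrimaryTorsion W p) vbar,
      conjSel₂ κ₁ κ₂ (geomPrimaryTorsion W p) vbar γ₁ s = s → x s = 0) :
    x ∈ (Ideal.span {(PowerSeries.X : IwasawaAlgebra₂ p)} •
      (⊤ : Submodule (IwasawaAlgebra₂ p) (W.XGr₂ p κ₁ κ₂ vbar γ₁ γ₂))) := by
  have key : ∀ s : unrSelmer₂ κ₁ κ₂ (geomPrimaryTorsion W p) vbar,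
      (conjSel₂ κ₁ κ₂ (geomPrimaryTorsion W p) vbar γ₁ - 1 :
        AddMonoid.End (unrSelmer₂ κ₁ κ₂ (geomPrimaryTorsion W p) vbar)) s =
      conjSel₂ κ₁ κ₂ (geomPrimaryTorsion W p) vbar γ₁ s - s := fun s ↦ by
    rw [IwasawaDual.End_sub_apply, AddMonoid.End.one_apply]
  obtain ⟨y, hy⟩ := AddMonoidHom.exists_comp_eq_of_forall_ker
    (conjSel₂ κ₁ κ₂ (geomPrimaryTorsion W p) vbar γ₁ - 1)
    (x : unrSelmer₂ κ₁ κ₂ (geomPrimaryTorsion W p) vbar →+ AddCircle (1 : ℚ)) fun s hs ↦ hx s (by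
      rw [key, sub_eq_zero] at hs
      exact hs)
  let y' : W.XGr₂ p κ₁ κ₂ vbar γ₁ γ₂ := y
  have hxy : x = (PowerSeries.X : IwasawaAlgebra₂ p) • y' := by
    refine DFunLike.ext _ _ fun s ↦ ?_
    rw [X_smul_apply]
    show x s = y (conjSel₂ κ₁ κ₂ (geomPrimaryTorsion W p) vbar γ₁ s) - y s
    rw [← map_sub, ← key, hy]
    rfl
  rw [Submodule.ideal_span_singleton_smul, hxy]
  exact Submodule.smul_mem_pointwise_smul _ _ _ Submodule.mem_top

/-- **Exact control, duality half: if restriction `Sel_v̄(K_∞⁻, E[p^∞]) → H¹_{nr,v̄}(K̃_∞, E[p^∞])^{γ₁ = 1}`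
is onto, then `toXAcQuot : X_Gr₂ ⧸ (T₁)·X_Gr₂ → X_ac` is injective.** A class `q = [x]` with
`toXAcQuot q = 0` has `x ∘ res = 0` (`toXAc_apply`); by hypothesis every `conj_{γ₁}`-fixed class is in
the range of `res`, so `x` kills them and `x ∈ (T₁)·X_Gr₂` by `mem_X_smul_top_of_forall`. (The converse
direction of Skinner–Urban 2014 Prop. 3.2.8 on the module side.)
[cite: SkinnerUrban2014, Prop. 3.2.8 (p. 23)] -/
theorem toXAcQuot_injective_of_forall_mem_range
    (h : ∀ s : unrSelmer₂ κ₁ κ₂ (geomPrimaryTorsion W p) vbar,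
      conjSel₂ κ₁ κ₂ (geomPrimaryTorsion W p) vbar γ₁ s = s →
        s ∈ Set.range (W.selmerAcToUnrSelmer₂ p κ₁ κ₂ vbar)) :
    Function.Injective (toXAcQuot W p κ₁ κ₂ vbar γ₁ γ₂) := by
  rw [injective_iff_map_eq_zero]
  intro q hq
  obtain ⟨x, rfl⟩ := Submodule.Quotient.mk_surjective _ q
  rw [toXAcQuot_mk] at hq
  rw [Submodule.Quotient.mk_eq_zero]
  refine mem_X_smul_top_of_forall W p κ₁ κ₂ vbar γ₁ γ₂ x fun s hs ↦ ?_
  obtain ⟨t, rfl⟩ := h s hs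
  have := DFunLike.congr_fun hq t
  rwa [toXAc_apply] at this

end WeierstrassCurve.XGr₂

end
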